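import Summits.AnomalousDissipation.AnomalousDissipation.Theses.TameDichotomy
import Literature.ModelTheory.ExponentialFields.OMinimalDefinability
import Literature.ModelTheory.ExponentialFields.OMinimalMonotonicityReal

/-!
# AnomalousDissipation / TameDichotomy — the Euler-limit split of the deciding crux
`TameSteadyWitness` (stmt-AnomalousDissipation-2850)

Crux-strategist decomposition (BC2 redirect of the RESTATED deciding crux, 2026-08-17).  The tame
steady witness `X = TameSteadyWitness` (an o-minimally definable family of bounded-energy classical
steady Navier–Stokes states with a dissipation floor as `ν → 0⁺`) is an `∃` over a family carrying
independent burdens, so exactly one piece stays existential and the others are laws over the class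
it produces:

* `TameEulerDissipator` (X₁, crux — the Euler-level half): a smooth steady divergence-free
  mean-zero force `f`, an o-minimal expansion `L` of the real ordered field and an `L`-definable
  field `ū ∈ L²(T³)`, weakly divergence-free, which is a steady weak (pressure-free) Euler solution
  with force `f` — `∫ ⟪ū, (ū·∇)w⟫ + ∫ ⟪f, w⟫ = 0` for all smooth divergence-free `w` — and ABSORBS
  POWER, `∫ ⟪f, ū⟫ > 0`.  (Smooth states absorb none; bounded ones neither, De Rosa–Drivas–Inversi;
  the negation is "tame steady Onsager rigidity", the Euler-level half of `NoTameCascade`.)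
* `TameViscousRealisation` (X₂, crux — the Navier–Stokes-level half): every such tame dissipator is
  the a.e. vanishing-viscosity limit of an o-minimally definable family `(u_ν, p_ν)`, `ν ∈ (0, δ)`,
  of bounded-energy classical steady `NS_ν(f)` states (same force).
* `PowerContinuity` (X₃, support — classical, Vitali): along such a family the power `∫ ⟪f, u_ν⟫`
  converges to `∫ ⟪f, ū⟫`.

`tameSteadyWitness_of_pieces : X₁ → X₂ → X₃ → X`.  Proof: realise the dissipator (X₂); by the
steady energy identity `ν ‖∇u_ν‖₂² = ∫ ⟪f, u_ν⟫` (the tree's energy equality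
`Torus.IsClassicalNSSolutionOn.energy_eq` on `[0, 1]` for the time-constant solution) and X₃ the
dissipation converges to `l = ∫ ⟪f, ū⟫ > 0`, hence exceeds `l / 2` on some `(0, δ₁)`
(`Filter.Tendsto.eventually_const_lt`, `mem_nhdsGT_iff_exists_Ioo_subset`); restrict the family to
`(0, min δ δ₁)`: steadiness and the energy bound restrict pointwise, and the definable graph over the
smaller interval is the old graph cut by the half-space `{v | v 0 < min δ δ₁}`, definable because an
expansion of the ordered ring defines `<` (`definable_lt_of_expansion`, `definable_setOf_lt`).

WORKFILE COPY (Cruxes/TameSteadyWitness/Lines/euler-limit-split-assembly.lean) of the prover-ready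
candidate `Theorems/TameDichotomyTameSteadyWitnessSplit.lean` attached as evidence on
stmt-AnomalousDissipation-2850 (planners cannot write Theorems, D-0016): namespace renamed to
`…Cruxes.TameSteadyWitness.EulerLimitSplit`, otherwise verbatim.  The three piece statements are
character-for-character the children filed by `ledger route edit … --split TameSteadyWitness`; the
theorem proves the split's glue item.

References: van den Dries 1998, Ch. 1 (2.3), (3.2) [Dries1998]; Doering–Foias 2002, §2 (energy
identity) [DoeringFoias2002]; Robinson–Rodrigo–Sadowski 2016, Thm. 6.5 [RobinsonRodrigoSadowski2016].
-/

-- `Summit.<Summit>.<Problem>` is the tree's mandated summit-side namespace (CONVENTIONS §2); for this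
-- single-conjunct summit the two coincide, so the duplicate is deliberate.
set_option linter.dupNamespace false

noncomputable section

namespace Summit.AnomalousDissipation.AnomalousDissipation.Cruxes.TameSteadyWitness.EulerLimitSplit

open scoped Topology InnerProductSpace
open Filter Set MeasureTheory
open Summit.AnomalousDissipation.AnomalousDissipation.Theses.TameDichotomy
open Literature.Analysis.FunctionSpaces Literature.ModelTheory.ExponentialFields

/-- Piece X₁ of the split of `TameDichotomy.TameSteadyWitness` — TAME EULER DISSIPATOR: a smooth
steady divergence-free mean-zero force `f` on `T³`, an o-minimal expansion `L` of `(ℝ,<,+,·)` and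
an `L`-definable (graph over the unit cube) field `ū ∈ L²`, weakly divergence-free, steady weak Euler
solution with force `f` (pressure-free weak form against smooth divergence-free tests), absorbing
power `∫ ⟪f, ū⟫ > 0`.  Character-for-character the route child `TameEulerDissipator`. [problem: turb] -/
def TameEulerDissipator : Prop :=
  ∃ f : UnitAddTorus (Fin 3) → EuclideanSpace ℝ (Fin 3), Literature.Analysis.FunctionSpaces.Torus.IsSmooth f ∧ Literature.Analysis.FunctionSpaces.Torus.IsDivFree f ∧ Literature.Analysis.FunctionSpaces.Torus.HasZeroMean f ∧ ∃ (L : FirstOrder.Language.{0, 0}) (_ : L.Structure ℝ) (φ : FirstOrder.Language.LHom Literature.ModelTheory.ExponentialFields.Language.orderedRing L) (_ : φ.IsExpansionOn ℝ), L.IsOMinimal ℝ ∧ ∃ ū : UnitAddTorus (Fin 3) → EuclideanSpace ℝ (Fin 3), (Set.univ : Set ℝ).Definable L {v : Fin 6 → ℝ | v 0 ∈ Set.Ico (0 : ℝ) 1 ∧ v 1 ∈ Set.Ico (0 : ℝ) 1 ∧ v 2 ∈ Set.Ico (0 : ℝ) 1 ∧ v 3 = ū (Literature.Analysis.FunctionSpaces.Torus.proj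 !₂[v 0, v 1, v 2]) 0 ∧ v 4 = ū (Literature.Analysis.FunctionSpaces.Torus.proj !₂[v 0, v 1, v 2]) 1 ∧ v 5 = ū (Literature.Analysis.FunctionSpaces.Torus.proj !₂[v 0, v 1, v 2]) 2} ∧ MeasureTheory.MemLp ū 2 MeasureTheory.volume ∧ Literature.Analysis.FunctionSpaces.Torus.IsWeaklyDivFree ū ∧ (∀ w : UnitAddTorus (Fin 3) → EuclideanSpace ℝ (Fin 3), Literature.Analysis.FunctionSpaces.Torus.IsSmooth w → Literature.Analysis.FunctionSpaces.Torus.IsDivFree w → ∫ x, inner ℝ (ū x) (Literature.Analysis.FunctionSpaces.Torus.convect ū w x) + ∫ x, inner ℝ (f x) (w x) = 0) ∧ 0 < ∫ x, inner ℝ (f x) (ū x)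

/-- Piece X₂ — TAME VISCOUS REALISATION: for every o-minimal `L`, smooth steady divergence-free
mean-zero `f` and `L`-definable tame Euler dissipator `ū` (the clauses of `TameEulerDissipator`),
there are an o-minimal expansion `L'`, `δ > 0` and an `L'`-definable family `(u_ν, p_ν)`,
`ν ∈ (0, δ)`, of classical steady `NS_ν(f)` states (graph over `(0, δ) ×` unit cube as in
`TameSteadyWitness`) with `∫ ‖u_ν‖² ≤ E` and `u_ν → ū` a.e. as `ν → 0⁺`.  Character-for-character
the route child `TameViscousRealisation`. [problem: turb] -/
def TameViscousRealisation : Prop :=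
  ∀ (L : FirstOrder.Language.{0, 0}) [L.Structure ℝ] (φ : FirstOrder.Language.LHom Literature.ModelTheory.ExponentialFields.Language.orderedRing L) [φ.IsExpansionOn ℝ], L.IsOMinimal ℝ → ∀ f : UnitAddTorus (Fin 3) → EuclideanSpace ℝ (Fin 3), Literature.Analysis.FunctionSpaces.Torus.IsSmooth f → Literature.Analysis.FunctionSpaces.Torus.IsDivFree f → Literature.Analysis.FunctionSpaces.Torus.HasZeroMean f → ∀ ū : UnitAddTorus (Fin 3) → EuclideanSpace ℝ (Fin 3), (Set.univ : Set ℝ).Definable L {v : Fin 6 → ℝ | v 0 ∈ Set.Ico (0 : ℝ) 1 ∧ v 1 ∈ Set.Ico (0 : ℝ) 1 ∧ v 2 ∈ Set.Ico (0 : ℝ) 1 ∧ v 3 = ū (Literature.Analysis.FunctionSpaces.Torus.proj !₂[v 0, v 1, v 2]) 0 ∧ v 4 = ū (Literature.Analysis.FunctionSpaces.Torus.proj !₂[v 0, v 1, v 2]) 1 ∧ v 5 = ū (Literature.Analysis.FunctionSpaces.Torus.proj !₂[v 0, v 1, v 2]) 2} → MeasureTheory.MemLp ū 2 MeasureTheory.volume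 → Literature.Analysis.FunctionSpaces.Torus.IsWeaklyDivFree ū → (∀ w : UnitAddTorus (Fin 3) → EuclideanSpace ℝ (Fin 3), Literature.Analysis.FunctionSpaces.Torus.IsSmooth w → Literature.Analysis.FunctionSpaces.Torus.IsDivFree w → ∫ x, inner ℝ (ū x) (Literature.Analysis.FunctionSpaces.Torus.convect ū w x) + ∫ x, inner ℝ (f x) (w x) = 0) → 0 < ∫ x, inner ℝ (f x) (ū x) → ∃ (L' : FirstOrder.Language.{0, 0}) (_ : L'.Structure ℝ) (φ' : FirstOrder.Language.LHom Literature.ModelTheory.ExponentialFields.Language.orderedRing L') (_ : φ'.IsExpansionOn ℝ), L'.IsOMinimal ℝ ∧ ∃ (δ : ℝ) (u : ℝ → UnitAddTorus (Fin 3) → EuclideanSpace ℝ (Fin 3)) (p : ℝ → UnitAddTorus (Fin 3) → ℝ), 0 < δ ∧ (Set.univ : Set ℝ).Definable L' {v : Fin 7 → ℝ | v 0 ∈ Set.Ioo 0 δ ∧ v 1 ∈ Set.Ico (0 : ℝ) 1 ∧ v 2 ∈ Set.Ico (0 : ℝ) 1 ∧ v 3 ∈ Set.Ico (0 : ℝ)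 1 ∧ v 4 = u (v 0) (Literature.Analysis.FunctionSpaces.Torus.proj !₂[v 1, v 2, v 3]) 0 ∧ v 5 = u (v 0) (Literature.Analysis.FunctionSpaces.Torus.proj !₂[v 1, v 2, v 3]) 1 ∧ v 6 = u (v 0) (Literature.Analysis.FunctionSpaces.Torus.proj !₂[v 1, v 2, v 3]) 2} ∧ (∀ ν ∈ Set.Ioo 0 δ, Literature.Analysis.FunctionSpaces.Torus.IsClassicalNSSolutionOn Set.univ ν (fun _ => f) (fun _ => u ν) (fun _ => p ν)) ∧ (∃ E : ℝ, ∀ ν ∈ Set.Ioo 0 δ, ∫ x, ‖u ν x‖ ^ 2 ≤ E) ∧ ∀ᵐ x, Filter.Tendsto (fun ν => u ν x) (nhdsWithin 0 (Set.Ioi 0)) (nhds (ū x))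

/-- Piece X₃ — POWER CONTINUITY (support; Vitali's convergence theorem specialised): for smooth
`f` and fields `u_ν`, smooth for `ν ∈ (0, δ)`, with `∫ ‖u_ν‖² ≤ E`, converging a.e. to `ū` as
`ν → 0⁺`, the power `∫ ⟪f, u_ν⟫` converges to `∫ ⟪f, ū⟫`.  Character-for-character the route child
`PowerContinuity`. [problem: turb] -/
def PowerContinuity : Prop :=
  ∀ (f : UnitAddTorus (Fin 3) → EuclideanSpace ℝ (Fin 3)), Literature.Analysis.FunctionSpaces.Torus.IsSmooth f → ∀ (δ : ℝ) (u : ℝ → UnitAddTorus (Fin 3) → EuclideanSpace ℝ (Fin 3)) (ū : UnitAddTorus (Fin 3) → EuclideanSpace ℝ (Fin 3)), 0 < δ → (∀ ν ∈ Set.Ioo 0 δ, Literature.Analysis.FunctionSpaces.Torus.IsSmooth (u ν)) → (∃ E : ℝ, ∀ ν ∈ Set.Ioo 0 δ, ∫ x, ‖u ν x‖ ^ 2 ≤ E) → (∀ᵐ x, Filter.Tendsto (fun ν => u ν x) (nhdsWithin 0 (Set.Ioi 0)) (nhds (ū x))) → Filter.Tendsto (fun ν => ∫ x, inner ℝ (f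 x) (u ν x)) (nhdsWithin 0 (Set.Ioi 0)) (nhds (∫ x, inner ℝ (f x) (ū x)))

/-- STEADY ENERGY IDENTITY: a time-constant classical solution of the forced Navier–Stokes system
on `ℝ × T³` satisfies `ν ‖∇u‖₂² = ∫ ⟪f, u⟫` (the tree's energy equality
`Torus.IsClassicalNSSolutionOn.energy_eq` on `[0, 1]`: the kinetic energies at `0` and `1` coincide,
the time integrals of constants are the constants; Doering–Foias 2002, §2 (2.4)).
[cite: DoeringFoias2002, §2 (2.4)] -/
theorem steady_energy_identity {ν : ℝ} {f u : UnitAddTorus (Fin 3) → EuclideanSpace ℝ (Fin 3)}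
    {p : UnitAddTorus (Fin 3) → ℝ}
    (h : Torus.IsClassicalNSSolutionOn Set.univ ν (fun _ => f) (fun _ => u) (fun _ => p)) :
    ν * Torus.gradNormSq u = ∫ x, inner ℝ (f x) (u x) := by
  have hE := h.energy_eq convex_univ (zero_le_one (α := ℝ)) (Set.subset_univ _)
  simp only [intervalIntegral.integral_const, sub_zero, one_smul] at hE
  linarith

/-- ASSEMBLY (glue) of the Euler-limit split of the deciding crux of route TameDichotomy:
`TameEulerDissipator → TameViscousRealisation → PowerContinuity → TameSteadyWitness`
(supports stmt-AnomalousDissipation-2850).  Realise the tame Euler dissipator `ū` of X₁ by the tame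
steady Navier–Stokes family of X₂; by the steady energy identity and X₃ the dissipation
`ν ‖∇u_ν‖₂²` converges to `l = ∫ ⟪f, ū⟫ > 0` as `ν → 0⁺`, so it exceeds `l / 2` on some
`(0, δ₁)`; the family restricted to `(0, min δ δ₁)` is the witness, its graph being the old
definable graph cut by the definable half-space `{v | v 0 < min δ δ₁}` (an expansion of the ordered
ring defines `<`, van den Dries 1998 Ch. 1 (3.2)). [cite: Dries1998, Ch. 1 (2.3), (3.2)] -/
theorem tameSteadyWitness_of_pieces (h₁ : TameEulerDissipator) (h₂ : TameViscousRealisation)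
    (h₃ : PowerContinuity) : TameSteadyWitness := by
  obtain ⟨f, hf, hdiv, hmean, L, instL, φ, instφ, hO, ū, hdef, hL2, hwdiv, hEuler, hpos⟩ := h₁
  -- realise the tame Euler dissipator by a tame steady Navier–Stokes family (X₂)
  obtain ⟨L', instL', φ', instφ', hO', δ, u, p, hδ, hdefu, hsol, hE, hae⟩ :=
    @h₂ L instL φ instφ hO f hf hdiv hmean ū hdef hL2 hwdiv hEuler hpos
  -- the absorbed power converges (X₃) ...
  have hsm : ∀ ν ∈ Set.Ioo 0 δ, Torus.IsSmooth (u ν) := fun ν hν =>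
    (hsol ν hν).smooth_velocity.isSmooth_slice (Set.mem_univ (0 : ℝ))
  have hP : Tendsto (fun ν => ∫ x, inner ℝ (f x) (u ν x)) (𝓝[>] 0)
      (𝓝 (∫ x, inner ℝ (f x) (ū x))) :=
    h₃ f hf δ u ū hδ hsm hE hae
  -- ... and equals the dissipation on `(0, δ)` (steady energy identity), so the dissipation converges
  have hD : Tendsto (fun ν => ν * Torus.gradNormSq (u ν)) (𝓝[>] 0)
      (𝓝 (∫ x, inner ℝ (f x) (ū x))) := by
    refine hP.congr' ?_
    filter_upwards [Ioo_mem_nhdsGT hδ] with ν hν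
    exact (steady_energy_identity (hsol ν hν)).symm
  -- a positive limit gives the floor `l / 2` on some `(0, δ₁)`
  set l : ℝ := ∫ x, inner ℝ (f x) (ū x) with hl
  have hev : ∀ᶠ ν in 𝓝[>] (0 : ℝ), l / 2 < ν * Torus.gradNormSq (u ν) :=
    hD.eventually_const_lt (by linarith)
  obtain ⟨δ₁, hδ₁, hsub⟩ := mem_nhdsGT_iff_exists_Ioo_subset.1 hev
  have hδ₁' : (0 : ℝ) < δ₁ := hδ₁
  -- restrict everything to `(0, δ')`, `δ' = min δ δ₁`
  refine ⟨f, hf, hdiv, hmean, L', instL', φ', instφ', hO', min δ δ₁, u, p, lt_min hδ hδ₁',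
    ?_, ?_, ?_, l / 2, by linarith, ?_⟩
  · -- the graph over `(0, δ')` is the graph over `(0, δ)` cut by the definable half-space `v 0 < δ'`
    have hlt := definable_lt_of_expansion (M := ℝ) φ'
    have hhalf : (Set.univ : Set ℝ).Definable L' {v : Fin 7 → ℝ | v 0 < min δ δ₁} :=
      definable_setOf_lt hlt (definableFun_proj 0) (definableFun_const' _ _)
    convert hdefu.inter hhalf using 1
    ext v
    simp only [Set.mem_setOf_eq, Set.mem_inter_iff, Set.mem_Ioo, lt_min_iff]
    constructor
    · rintro ⟨⟨h0, hδa, hδb⟩, hrest⟩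
      exact ⟨⟨⟨h0, hδa⟩, hrest⟩, hδa, hδb⟩
    · rintro ⟨⟨⟨h0, hδa⟩, hrest⟩, -, hδb⟩
      exact ⟨⟨h0, hδa, hδb⟩, hrest⟩
  · intro ν hν
    exact hsol ν ⟨hν.1, hν.2.trans_le (min_le_left _ _)⟩
  · obtain ⟨E, hE⟩ := hE
    exact ⟨E, fun ν hν => hE ν ⟨hν.1, hν.2.trans_le (min_le_left _ _)⟩⟩
  · intro ν hν
    exact (hsub ⟨hν.1, hν.2.trans_le (min_le_right _ _)⟩).le

end Summit.AnomalousDissipation.AnomalousDissipation.Cruxes.TameSteadyWitness.EulerLimitSplit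

end
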